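import Summits.HodgeConjecture.HodgeConjecture.Theses.TropicalWeilObstruction

/-!
# `TropicalWeilVanishing` (stmt-HodgeConjecture-18478) · Negative · `IsWeilGeneric` is load-bearing

Negative-side knowledge for the crux `TropicalWeilObstruction.TropicalWeilVanishing` (K1 of the
refutation route `route-HodgeConjecture-TropicalWeilObstruction`: at a Weil-generic period matrix `Q`
every effective tropical `4`-cycle on `ℝ⁸ / Q·ℤ⁸` has Weil functional `W(Z) = 0`), from the
crux-attack of refuter `rattack-stmt-HodgeConjecture-18478` (2026-08-17). Everything is unconditional
and sorry-free; the file introduces no `Prop` definition (the hypothesis-deleted crux is stated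
inline), only the combinatorial data of one explicit cycle.

* `kuhnCycle` — the first NON-EMPTY inhabitant of the certificate type
  `Literature.AlgebraicGeometry.Tropical.TropicalTorusCycle` in the tree: the coordinate 4-subtorus
  `ℝ⁴/ℤ⁴ × {0} ⊂ ℝ⁸/ℤ⁸` (period matrix `Q = 1`), Kuhn–Freudenthal triangulated — 24 lattice
  simplices `σ_π = conv(s₀, …, s₄)`, `s_k = Σ_{m<k} e_{π m}` (`π ∈ S₄` in lex order, tables `permTab`,
  `cls`, …), unit weights, frames `(e_{π0} | … | e_{π3})`, 60 facet classes (36 interior facets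
  `{π, π∘(i-1 i)}` at slot `i ∈ {1,2,3}`, shift `0`; 24 wrap-around facets pairing slot `0` of `π`
  with slot `4` of `(π1 π2 π3 π0)`, period shift `e_{π0}`), all facet permutations `1`. The two
  certificate identities (`facet_eq`, `balanced`) are integer identities checked by `decide`
  (`facet_id`, `balanced_id`: balancing of a class `{(π,i),(π',i')}` is `(-1)^i sgn π + (-1)^{i'} sgn π' = 0`).
* `weilFunctional_kuhnCycle` — `W(kuhnCycle) = Σ_π 1 · (1/4!) · (sgn π)² = 1`: every frame is a
  column permutation of `(e₀|e₁|e₂|e₃)`, whose complex `dz`-minor is `det 1 = 1`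
  (`frameComplexDet_Fz`), and every cell has lattice volume `1/24` (`latticeVolume_cellK`).
* `tropicalWeilVanishing_false_without_isWeilGeneric` — **the crux with `IsWeilGeneric 4 Q` deleted is
  FALSE**: `Q = 1` is positive definite and commutes with `weilJ 4`, and `kuhnCycle` has `W = 1 ≠ 0`.
  Any proof of K1 must therefore use the genericity of the period matrix; `not_isWeilGeneric_one`
  records that the witness does not touch K1 itself (`Q = 1` has the free coordinate `Q₀₁ = 0`, an
  algebraic number). On paper the combinatorial type of `kuhnCycle` realises as a tropical cycle on
  `ℝ⁸ / Q·ℤ⁸`, `Q = [[A,B],[-B,A]]`, exactly over the locus `B = 0` (its cells are chained through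
  shared facets, so all vertices lie in one affine 4-plane `V`; the wrap-around identifications force
  `Q e_0, …, Q e_3 ∈ V`, and rationality of `V`'s slope then forces `B = 0`): deformation rank
  `10 < 16`, a worked instance of the rank test any K1-killing type must pass at full rank `16`.

References: G. Mikhalkin, I. Zharkov, *Tropical eigenwave and intermediate Jacobians* (2014), Def. 4.2,
Prop. 4.3 (effective tropical cycles, cycle class); I. Zharkov, *Tropical abelian varieties, Weil
classes and the Hodge conjecture*, arXiv:2002.02347 (2020), §2 (the Weil tori `Q = [[A,B],[-B,A]]`,
`θ`, `w₁`, `w₂`); H. Freudenthal, *Simplizialzerlegungen von beschränkter Flachheit*, Ann. Math. 43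
(1942) (the Kuhn–Freudenthal triangulation of the cube) [folklore].
-/

-- `Summit.HodgeConjecture.HodgeConjecture.Theorems…` is the mandated namespace (single-conjunct summit:
-- Sub = Summit), which `linter.dupNamespace` flags on every declaration; the lakefile turns the
-- linter off tree-wide (weak option), restated here so stand-alone elaboration is warning-free too.
set_option linter.dupNamespace false

namespace Summit.HodgeConjecture.HodgeConjecture.Theorems.TropicalWeilVanishing.Negative

open Literature.AlgebraicGeometry.Tropical Matrix

/-! ### Combinatorial tables of the Kuhn–Freudenthal triangulation (generated and cross-checked by
script; every use below is re-verified by `decide`) -/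

/-- The 24 permutations `π` of `Fin 4` in lexicographic order, as value tables (cell index `σ ↦ π`).
[folklore] -/
def permTab : Fin 24 → Fin 4 → Fin 4 :=
  ![![0, 1, 2, 3], ![0, 1, 3, 2], ![0, 2, 1, 3], ![0, 2, 3, 1], ![0, 3, 1, 2], ![0, 3, 2, 1],
    ![1, 0, 2, 3], ![1, 0, 3, 2], ![1, 2, 0, 3], ![1, 2, 3, 0], ![1, 3, 0, 2], ![1, 3, 2, 0],
    ![2, 0, 1, 3], ![2, 0, 3, 1], ![2, 1, 0, 3], ![2, 1, 3, 0], ![2, 3, 0, 1], ![2, 3, 1, 0],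
    ![3, 0, 1, 2], ![3, 0, 2, 1], ![3, 1, 0, 2], ![3, 1, 2, 0], ![3, 2, 0, 1], ![3, 2, 1, 0]]

/-- The inverse permutations `π⁻¹`, row by row matching `permTab`. [folklore] -/
def invTab : Fin 24 → Fin 4 → Fin 4 :=
  ![![0, 1, 2, 3], ![0, 1, 3, 2], ![0, 2, 1, 3], ![0, 3, 1, 2], ![0, 2, 3, 1], ![0, 3, 2, 1],
    ![1, 0, 2, 3], ![1, 0, 3, 2], ![2, 0, 1, 3], ![3, 0, 1, 2], ![2, 0, 3, 1], ![3, 0, 2, 1],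
    ![1, 2, 0, 3], ![1, 3, 0, 2], ![2, 1, 0, 3], ![3, 1, 0, 2], ![2, 3, 0, 1], ![3, 2, 0, 1],
    ![1, 2, 3, 0], ![1, 3, 2, 0], ![2, 1, 3, 0], ![3, 1, 2, 0], ![2, 3, 1, 0], ![3, 2, 1, 0]]

/-- `π⁻¹ ∘ π = id`, checked by `decide`. [folklore] -/
theorem invTab_permTab : ∀ σ m, invTab σ (permTab σ m) = m := by decide
/-- `π ∘ π⁻¹ = id`, checked by `decide`. [folklore] -/
theorem permTab_invTab : ∀ σ m, permTab σ (invTab σ m) = m := by decide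

/-- The 24 permutations of `Fin 4`, as computable `Equiv.Perm`s [folklore] -/
def permE (σ : Fin 24) : Equiv.Perm (Fin 4) :=
  ⟨permTab σ, invTab σ, invTab_permTab σ, permTab_invTab σ⟩

/-- The signs `sgn π` of the 24 permutations (lex order). [folklore] -/
def eps : Fin 24 → ℤ :=
  ![1, -1, -1, 1, 1, -1, -1, 1, 1, -1, -1, 1, 1, -1, -1, 1, 1, -1, -1, 1, 1, -1, -1, 1]

/-- The sign table is correct: `sgn (permE σ) = eps σ`, checked by `decide`. [folklore] -/
theorem sign_permE : ∀ σ, ((Equiv.Perm.sign (permE σ) : ℤˣ) : ℤ) = eps σ := by decide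

/-- Facet-class table: `cls σ i` is the class (one of 60) of the `i`-th facet of cell `σ`; slots
`i ∈ {1,2,3}` pair `π` with `π ∘ (i-1 i)`, slot `0` of `π` pairs with slot `4` of `(π1 π2 π3 π0)`. [folklore] -/
def cls : Fin 24 → Fin 5 → Fin 60 :=
  ![![0, 1, 2, 3, 4], ![5, 6, 7, 3, 8], ![9, 10, 2, 11, 12], ![13, 14, 15, 11, 16],
    ![17, 18, 7, 19, 20], ![21, 22, 15, 19, 23], ![16, 1, 24, 25, 26], ![23, 6, 27, 25, 28],
    ![29, 30, 24, 31, 32], ![33, 34, 35, 31, 0], ![36, 37, 27, 38, 39], ![40, 41, 35, 38, 5],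
    ![8, 10, 42, 43, 44], ![20, 14, 45, 43, 29], ![28, 30, 42, 46, 47], ![39, 34, 48, 46, 9],
    ![49, 50, 45, 51, 33], ![52, 53, 48, 51, 13], ![4, 18, 54, 55, 49], ![12, 22, 56, 55, 36],
    ![26, 37, 54, 57, 52], ![32, 41, 58, 57, 17], ![44, 50, 56, 59, 40], ![47, 53, 58, 59, 21]]

/-- A representative cell of each facet class (chosen with zero period shift). [folklore] -/
def repCell : Fin 60 → Fin 24 :=
  ![9, 0, 0, 0, 0, 11, 1, 1, 1, 15, 2, 2, 2, 17, 3, 3, 3, 21, 4, 4, 4, 23, 5, 5, 6, 6, 6, 7, 7, 13,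
    8, 8, 8, 16, 9, 9, 19, 10, 10, 10, 22, 11, 12, 12, 12, 13, 14, 14, 15, 18, 16, 16, 20, 17, 18,
    18, 19, 20, 21, 22]

/-- The facet slot of the representative `repCell f` lying in class `f`. [folklore] -/
def repIdx : Fin 60 → Fin 5 :=
  ![4, 1, 2, 3, 4, 4, 1, 2, 4, 4, 1, 3, 4, 4, 1, 2, 4, 4, 1, 3, 4, 4, 1, 4, 2, 3, 4, 2, 4, 4, 1, 3,
    4, 4, 1, 2, 4, 1, 3, 4, 4, 1, 2, 3, 4, 2, 3, 4, 2, 4, 1, 3, 4, 1, 2, 3, 2, 3, 2, 3]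

/-- The standard frame `e₀, e₁, e₂, e₃` of `ℤ⁸` [folklore] -/
def L0 : Matrix (Fin 8) (Fin 4) ℤ := fun a m => if (a : ℕ) = (m : ℕ) then 1 else 0

/-- Frame of cell `σ`: columns `e_{π 0}, …, e_{π 3}` [folklore] -/
def Fz (σ : Fin 24) : Matrix (Fin 8) (Fin 4) ℤ := fun a m => L0 a (permE σ m)

/-- Vertices `s_k = Σ_{m<k} e_{π m}` [folklore] -/
def Vz (σ : Fin 24) (k : Fin 5) (a : Fin 8) : ℤ :=
  ∑ m : Fin 4, if (m : ℕ) < (k : ℕ) then Fz σ a m else 0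

/-- Period shift of facet slot `(σ, i)`: `e_{π 0}` for `i = 0`, else `0` [folklore] -/
def Sz (σ : Fin 24) (i : Fin 5) (a : Fin 8) : ℤ :=
  if (i : ℕ) = 0 ∧ (a : ℕ) = (permE σ 0 : ℕ) then 1 else 0

/-- Reference facet of a class = the facet of its representative slot (which has zero shift).
[folklore] -/
def Rz (f : Fin 60) (j : Fin 4) (a : Fin 8) : ℤ := Vz (repCell f) ((repIdx f).succAbove j) a

set_option maxRecDepth 200000 in
/-- Certificate identity 1 (closedness data): the `i`-th facet of cell `σ` is its class
representative translated by the period shift `Sz σ i` (here `Q = 1`, facet permutation `1`);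
an integer identity, checked cell by cell by `decide`. [folklore] -/
theorem facet_id : ∀ σ i j a, Vz σ (Fin.succAbove i j) a = Rz (cls σ i) j a + Sz σ i a := by
  intro σ; fin_cases σ <;> decide

set_option maxRecDepth 200000 in
/-- Certificate identity 2 (balancing), reduced form: in every facet class the signed count
`Σ (-1)^i sgn π` over its slots vanishes (each class has two slots of opposite sign); checked by
`decide`. The full balancing `Σ w (-1)^i sgn(ρ) [L_S] = 0` factors through it (`plucker_Fz`). [folklore] -/
theorem balanced_id : ∀ f : Fin 60,
    (∑ σ : Fin 24, ∑ i : Fin 5, if cls σ i = f then (-1 : ℤ) ^ (i : ℕ) * eps σ else 0) = 0 := by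
  intro f; fin_cases f <;> decide

/-- Every frame `(e_{π0}|…|e_{π3})` has the integer left inverse `Fzᵀ` (saturation). [folklore] -/
theorem frame_leftinv : ∀ σ : Fin 24, (Fz σ).transpose * Fz σ = 1 := by decide

/-! ### Cells, frames, the cycle, its Weil functional -/
/-- Upper unitriangular all-ones `4 × 4` matrix: the edge coefficients `s_{j+1} = Σ_{m ≤ j} e_{π m}`.
[folklore] -/
def Uz : Matrix (Fin 4) (Fin 4) ℤ := fun m j => if m ≤ j then 1 else 0

/-- `det Uz = 1` (upper unitriangular). [folklore] -/
theorem Uz_det : Uz.det = 1 := by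
  rw [Matrix.det_of_upperTriangular]
  · simp [Uz]
  · intro i j hij
    exact if_neg (not_le.mpr hij)

set_option maxRecDepth 200000 in
/-- Edge vectors in the frame: `s_{j+1} - s_0 = Σ_{m ≤ j} e_{π m} = (Fz σ · Uz)_j`, checked by
`decide`. [folklore] -/
theorem vert_id : ∀ σ (j : Fin 4) (a : Fin 8),
    Vz σ j.succ a - Vz σ 0 a = ∑ m : Fin 4, Fz σ a m * Uz m j := by
  intro σ; fin_cases σ <;> decide

/-- Plücker coordinates of a permuted frame: `[Fz σ]_S = sgn π · [e₀e₁e₂e₃]_S`. [folklore] -/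
theorem plucker_Fz (σ : Fin 24) (S : Fin 4 → Fin 8) :
    pluckerCoord (Fz σ) S = eps σ * pluckerCoord L0 S := by
  have h : (Fz σ).submatrix S id = (L0.submatrix S id).submatrix id (permE σ) := rfl
  rw [pluckerCoord, pluckerCoord, h, Matrix.det_permute']
  simp [sign_permE]

/-- The cells of the Kuhn triangulation of the coordinate 4-subtorus `ℝ⁴/ℤ⁴ × 0 ⊂ ℝ⁸/ℤ⁸` [folklore] -/
noncomputable def cellK (σ : Fin 24) : TropicalCell (2 * 4) 4 where
  weight := 1
  weight_pos := one_pos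
  vertex := fun k a => (Vz σ k a : ℝ)
  frame := Fz σ
  edgeCoeff := Uz.map (Int.cast : ℤ → ℝ)
  vertex_succ_sub := by
    intro j a
    have h := congrArg (Int.cast : ℤ → ℝ) (vert_id σ j a)
    push_cast at h
    simpa [Matrix.map_apply] using h
  edgeCoeff_det_pos := by
    rw [← Int.cast_det, Uz_det]
    norm_num
  frame_saturated := ⟨(Fz σ).transpose, frame_leftinv σ⟩

/-- Each Kuhn simplex has normalised lattice volume `det Uz / 4! = 1/24`. [folklore] -/
theorem latticeVolume_cellK (σ : Fin 24) : (cellK σ).latticeVolume = 1 / 24 := by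
  simp only [TropicalCell.latticeVolume, cellK]
  rw [← Int.cast_det, Uz_det]
  norm_num [Nat.factorial]

/-- The complex `dz`-minor of a permuted coordinate frame is `sgn π`: the frame has no
`e_{k+4}`-components, so `[(l_j)_k + i (l_j)_{k+4}] = 1.submatrix id π`. [folklore] -/
theorem frameComplexDet_Fz (σ : Fin 24) :
    frameComplexDet 4 (Fz σ) = (((Equiv.Perm.sign (permE σ) : ℤˣ) : ℤ) : ℂ) := by
  have h1 : ((1 : Matrix (Fin 4) (Fin 4) ℂ).submatrix id ⇑(permE σ)).det
      = (((Equiv.Perm.sign (permE σ) : ℤˣ) : ℤ) : ℂ) := by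
    rw [Matrix.det_permute', Matrix.det_one, mul_one]
  rw [← h1]
  unfold frameComplexDet
  congr 1
  ext k j
  have hk : ¬ ((k : ℕ) + 4 = ((permE σ j : Fin 4) : ℕ)) := by omega
  simp [Fz, L0, Matrix.one_apply, hk, Fin.ext_iff]

/-- Hence `η_σ² = (sgn π)² = 1` for every cell. [folklore] -/
theorem frameComplexDet_Fz_sq (σ : Fin 24) : frameComplexDet 4 (Fz σ) ^ 2 = 1 := by
  rw [frameComplexDet_Fz]
  rcases Int.units_eq_one_or (Equiv.Perm.sign (permE σ)) with h | h <;> simp [h]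

/-- **The Kuhn subtorus cycle.** The coordinate 4-subtorus `ℝ⁴/ℤ⁴ × {0}` of `ℝ⁸/ℤ⁸`,
Kuhn–Freudenthal triangulated (24 unit-weight lattice simplices, 60 facet classes, all facet
permutations `1`), as an effective tropical 4-cycle on the tropical torus with period matrix `Q = 1`
— a non-empty inhabitant of the certificate type `TropicalTorusCycle (2 * 4) 4 1`.
[cite: MikhalkinZharkov2014Eigenwave, Def. 4.2, Prop. 4.3] [folklore] -/
noncomputable def kuhnCycle :
    TropicalTorusCycle (2 * 4) 4 (1 : Matrix (Fin (2 * 4)) (Fin (2 * 4)) ℝ) where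
  numCells := 24
  cell := cellK
  numFacetClasses := 60
  refFacet := fun f j a => (Rz f j a : ℝ)
  facetClass := cls
  facetPerm := fun _ _ => 1
  facetShift := Sz
  facet_eq := by
    intro σ i j a
    have h := congrArg (Int.cast : ℤ → ℝ) (facet_id σ i j a)
    push_cast at h
    simp only [Equiv.Perm.one_apply, Matrix.one_apply, boole_mul, Finset.sum_ite_eq,
      Finset.mem_univ, if_true]
    simpa [cellK] using h
  balanced := by
    intro f S
    have key : ∀ (σ : Fin 24) (i : Fin (4 + 1)),
        (if cls σ i = f then ((cellK σ).weight : ℤ) * (-1) ^ (i : ℕ) *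
            ((Equiv.Perm.sign ((fun (_ : Fin 24) (_ : Fin (4 + 1)) => (1 : Equiv.Perm (Fin 4))) σ i)
              : ℤˣ) : ℤ) * pluckerCoord (cellK σ).frame S else 0)
          = pluckerCoord L0 S * (if cls σ i = f then (-1 : ℤ) ^ (i : ℕ) * eps σ else 0) := by
      intro σ i
      split_ifs
      · simp only [cellK, Nat.cast_one, one_mul, Equiv.Perm.sign_one, Units.val_one, mul_one,
          plucker_Fz]
        ring
      · simp
    simp_rw [key, ← Finset.mul_sum, balanced_id f, mul_zero]

/-- **`W(kuhnCycle) = 1`**: `Σ_{π ∈ S₄} 1 · (1/24) · (sgn π)² = 1`. In particular the coordinate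
subtorus `ℝ⁴/ℤ⁴ × 0 ⊂ ℂ⁴/ℤ[i]⁴` (a totally real abelian-subvariety-like cycle at the CM point
`Q = 1`) is an effective tropical 4-cycle off the theta line `W = 0`. [folklore] -/
theorem weilFunctional_kuhnCycle : weilFunctional kuhnCycle = 1 := by
  show (∑ σ : Fin 24, ((cellK σ).weight : ℂ) * (((cellK σ).latticeVolume : ℝ) : ℂ) *
      frameComplexDet 4 (cellK σ).frame ^ 2) = 1
  simp only [latticeVolume_cellK]
  simp [cellK, frameComplexDet_Fz_sq]

/-! ### The crux without `IsWeilGeneric` is false -/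

/-- **`IsWeilGeneric` is load-bearing in K1.** The crux `TropicalWeilObstruction.TropicalWeilVanishing`
with its genericity hypothesis `IsWeilGeneric 4 Q` deleted (positive definiteness and `QJ = JQ` kept,
verbatim otherwise) is FALSE: `Q = 1` is positive definite (`Matrix.PosDef.one`), commutes with
`weilJ 4`, and carries the effective tropical 4-cycle `kuhnCycle` with `W = 1 ≠ 0`. Any proof of the
crux must use `IsWeilGeneric 4 Q`. [folklore] -/
theorem tropicalWeilVanishing_false_without_isWeilGeneric :
    ¬ (∀ Q : Matrix (Fin (2 * 4)) (Fin (2 * 4)) ℝ, Q.PosDef → Q * weilJ 4 = weilJ 4 * Q →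
        ∀ Z : TropicalTorusCycle (2 * 4) 4 Q, weilFunctional Z = 0) := by
  intro h
  have h1 := h 1 Matrix.PosDef.one (by rw [Matrix.mul_one, Matrix.one_mul]) kuhnCycle
  rw [weilFunctional_kuhnCycle] at h1
  exact one_ne_zero h1

/-! ### The witness misses K1 itself -/

/-- `Q = 1` is **not** Weil-generic: its free coordinate `Q₀₁ = 0` is algebraic, so the indexed family
of free entries is not even `ℚ`-linearly independent. Hence `kuhnCycle` refutes only the crux with
`IsWeilGeneric` deleted, not the crux. [folklore] -/
theorem not_isWeilGeneric_one : ¬ IsWeilGeneric 4 (1 : Matrix (Fin (2 * 4)) (Fin (2 * 4)) ℝ) := by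
  intro h
  have h01 := h.linearIndependent.ne_zero ⟨((0 : Fin (2 * 4)), (1 : Fin (2 * 4))), by decide⟩
  exact h01 (Matrix.one_apply_ne (by decide))

end Summit.HodgeConjecture.HodgeConjecture.Theorems.TropicalWeilVanishing.Negative
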